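import Mathlib
import HarnessLib
import Summits.ValiantsHypothesis.ValiantsHypothesis.Theorems.MonotoneRestorationOrbitRestorationQPSmlAffineNarrow

/-!
# The Δ-witness lower bound for affine column-set-multilinear `ΣΠΣ` circuits (the engine behind the permanent bound)
(crux `OrbitRestorationQP`, stmt-ValiantsHypothesis-18293 — lane SML of stub A_∞)

The lower-bound mechanism of `…SmlAffinePermanent.lean`, packaged for reuse on any row- and column-symmetric target: if an affine
column-sml expression `F = Σ_{t<s} Π_b (β_{t,b} + Σ_a α_{t,b,a} x_{(a,b)})` is row- and column-symmetric and has FEWER than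
`C(n-j, j)` product gates (`2j ≤ n`), then for every family of `j` DISJOINT PAIRS `(a i, b i)` of variables the difference derivation
`Δ_{a,b} = Π_i (∂_{y_{a i}} - ∂_{y_{b i}})` kills every homogeneous component of the symmetric shadow `rename fst F`
(`SmlAffineNarrow.narrow_component_of_affineColSml_lt_choose` + `(N1)` `SmlDeltaCalculus.deltaFold_psumProd_eq_zero_of_narrow`).

* `deltaFold_homogeneousComponent_shadow_eq_zero` — the statement above;
* `affineColSml_lower_bound_of_deltaWitness` — **contrapositive: a Δ-WITNESS (some `e` and some `j` disjoint pairs with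
  `Δ (Hom_e (rename fst F)) ≠ 0`) forces `s ≥ C(n-j, j)`.**

For the permanent the witness is `Δ (y_1⋯y_n) ≠ 0` (`…SmlAffinePermanent.lean`); other matrix-symmetric column-multilinear targets
(sub-permanent sums, pattern counts) are handled by exhibiting their own witness.  Honest label: restricted-model lower-bound
engine; nothing here bears on general `ΣΠΣ` or on VP ≠ VNP. [folklore]
-/

noncomputable section

open scoped Classical

-- `Summit.ValiantsHypothesis.ValiantsHypothesis.…` is the tree's single-conjunct layout (Sub = Summit).
set_option linter.dupNamespace false

namespace Summit.ValiantsHypothesis.ValiantsHypothesis.Theorems.SmlAffinePermanent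

open MvPolynomial Finset SmlDeltaCalculus SmlAffineNarrow

/-- **Small affine column-sml circuits have Δ-annihilated shadows.**  For a row- and column-symmetric affine column-sml expression
with `s < C(n-j, j)` product gates (`2j ≤ n`) and `j` disjoint pairs `(a i, b i)`, every homogeneous component of the symmetric
shadow is killed by `Δ_{a,b}`. [folklore] -/
theorem deltaFold_homogeneousComponent_shadow_eq_zero {n s j : ℕ} (h2j : 2 * j ≤ n) (β : Fin s → Fin n → ℂ)
    (α : Fin s → Fin n → Fin n → ℂ)
    (hrow : ∀ σ : Equiv.Perm (Fin n), rename (fun v : Fin n × Fin n => (σ v.1, v.2))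
      (∑ t : Fin s, ∏ b : Fin n, (C (β t b) + ∑ a : Fin n, C (α t b a) * X (a, b)) : MvPolynomial (Fin n × Fin n) ℂ) =
      ∑ t : Fin s, ∏ b : Fin n, (C (β t b) + ∑ a : Fin n, C (α t b a) * X (a, b)))
    (hcol : ∀ τ : Equiv.Perm (Fin n), rename (fun v : Fin n × Fin n => (v.1, τ v.2))
      (∑ t : Fin s, ∏ b : Fin n, (C (β t b) + ∑ a : Fin n, C (α t b a) * X (a, b)) : MvPolynomial (Fin n × Fin n) ℂ) =
      ∑ t : Fin s, ∏ b : Fin n, (C (β t b) + ∑ a : Fin n, C (α t b a) * X (a, b)))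
    (hs : s < Nat.choose (n - j) j) (a b : Fin j → Fin n) (ha : Function.Injective a) (hb : Function.Injective b)
    (hab : ∀ i i', a i ≠ b i') (e : ℕ) :
    List.foldl (fun (q : MvPolynomial (Fin n) ℂ) i => pderiv (a i) q - pderiv (b i) q)
      (homogeneousComponent e (rename (Prod.fst : Fin n × Fin n → Fin n)
        (∑ t : Fin s, ∏ b : Fin n, (C (β t b) + ∑ a : Fin n, C (α t b a) * X (a, b)))))
      (List.finRange j) = 0 := by
  classical
  obtain ⟨S, c, hS, hcomp⟩ := narrow_component_of_affineColSml_lt_choose h2j β α hrow hcol hs e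
  rw [hcomp, deltaFoldList_sum]
  refine Finset.sum_eq_zero fun μ hμ => ?_
  obtain ⟨hpos, _, hcard⟩ := hS μ hμ
  rw [deltaFoldList_smul, deltaFold_psumProd_eq_zero_of_narrow j a b ha hb hab μ hpos hcard, smul_zero]

/-- **Δ-WITNESS ⇒ LOWER BOUND.**  If some homogeneous component of the symmetric shadow of a row- and column-symmetric affine
column-sml expression is NOT killed by the difference derivation of some `j` disjoint pairs (`2j ≤ n`), the expression has at
least `C(n-j, j)` product gates. [folklore] -/
theorem affineColSml_lower_bound_of_deltaWitness {n s j : ℕ} (h2j : 2 * j ≤ n) (β : Fin s → Fin n → ℂ)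
    (α : Fin s → Fin n → Fin n → ℂ)
    (hrow : ∀ σ : Equiv.Perm (Fin n), rename (fun v : Fin n × Fin n => (σ v.1, v.2))
      (∑ t : Fin s, ∏ b : Fin n, (C (β t b) + ∑ a : Fin n, C (α t b a) * X (a, b)) : MvPolynomial (Fin n × Fin n) ℂ) =
      ∑ t : Fin s, ∏ b : Fin n, (C (β t b) + ∑ a : Fin n, C (α t b a) * X (a, b)))
    (hcol : ∀ τ : Equiv.Perm (Fin n), rename (fun v : Fin n × Fin n => (v.1, τ v.2))
      (∑ t : Fin s, ∏ b : Fin n, (C (β t b) + ∑ a : Fin n, C (α t b a) * X (a, b)) : MvPolynomial (Fin n × Fin n) ℂ) =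
      ∑ t : Fin s, ∏ b : Fin n, (C (β t b) + ∑ a : Fin n, C (α t b a) * X (a, b)))
    (a b : Fin j → Fin n) (ha : Function.Injective a) (hb : Function.Injective b) (hab : ∀ i i', a i ≠ b i') (e : ℕ)
    (hwit : List.foldl (fun (q : MvPolynomial (Fin n) ℂ) i => pderiv (a i) q - pderiv (b i) q)
      (homogeneousComponent e (rename (Prod.fst : Fin n × Fin n → Fin n)
        (∑ t : Fin s, ∏ b : Fin n, (C (β t b) + ∑ a : Fin n, C (α t b a) * X (a, b)))))
      (List.finRange j) ≠ 0) :
    Nat.choose (n - j) j ≤ s := by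
  by_contra hs
  exact hwit (deltaFold_homogeneousComponent_shadow_eq_zero h2j β α hrow hcol (not_le.1 hs) a b ha hb hab e)

end Summit.ValiantsHypothesis.ValiantsHypothesis.Theorems.SmlAffinePermanent

end
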